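import Literature.Probability.LatticeModels.DominationFromNoBadPercolation
import Literature.Probability.LatticeModels.TailTrivialGibbs
import Literature.Probability.LatticeModels.ButterflyPeriodicity
import Literature.Probability.LatticeModels.StarZhangCrossing
import Literature.Probability.Percolation.StarWindingBands
import HarnessLib

/-!
# No (+,−)-percolation from good crossings above and below a square
# (Georgii–Higuchi 2000, end of the proof of Lemma 5.5)

Topic `Probability/LatticeModels`; theorems only. Georgii–Higuchi, J. Math. Phys. 41 (2000),
proof of Lemma 5.5, last paragraph (p. 16): "let `A_{x,y}` denote the event that there exist a
`≤∗`path from `x` to `y` above `Δ`, and `B_{x,y}` the event that such a path exists below `Δ`. The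
indicator functions of these events can be written as increasing functions `f` resp. `g` of the
difference configuration `ω̂ - ω`. Using the positive correlations of `μ̂` and `μ` we thus obtain
`ν̂(A_{x,y} ∩ B_{x,y}) ≥ ∫μ(dω) μ̂(f(·-ω)) μ̂(g(·-ω)) ≥ ν̂(A_{x,y}) ν̂(B_{x,y}) ≥ (θ/4)⁴` … if
`A_{x,y} ∩ B_{x,y}` occurs then `Δ` is surrounded by a `≤∗`circuit."

Here `ν̂ = μ ⊗ μ'` for two tail-trivial Ising Gibbs measures, a site `z` is *good* for the pair
`(ω, ω̂)` when `ω z ≤ ω̂ z` (i.e. it is not a bad site `ω z = +1, ω̂ z = -1` of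
`DominationFromNoBadPercolation.badConfig`), `Δ = Λ_n`, `x = (-a, 0)`, `y = (b, 0)` with `a, b > n`,
and, as in the tree's eye lemma (`Percolation.StarWindingBands`), "above `Δ`" means "avoiding the
lower band `{|z₁| ≤ n, z₂ ≤ n}`" and "below `Δ`" means "avoiding the upper band `{|z₁| ≤ n, z₂ ≥ -n}`":

* `prod_integral_mul_ge_of_antitone_monotone` — **positive correlations of the duplicated system**
  for functions decreasing in the first and increasing in the second layer (the displayed chain of
  inequalities), and its event form `prod_measureReal_inter_ge_of_antitone_monotone`;
* `badCluster_finite_of_goodCrossings` — **enclosure**: on `A_{x,y} ∩ B_{x,y}` every bad cluster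
  meeting `Λ_n` is finite (the eye lemma `exists_mem_support_of_bandSemicircuits`);
* `measure_goodCrossings_mul_le` — `ν̂(A_{x,y}) ν̂(B_{x,y}) ≤ ν̂(no infinite bad cluster meets Λ_n)`;
* `preimage_reflect_upperGoodCrossing` and `measure_lowerGoodCrossing_eq` — the lower event is the
  upper event of the pair reflected in the horizontal axis ("its analogue for the lower
  half-plane").

## References

* H.-O. Georgii, Y. Higuchi, J. Math. Phys. 41 (2000) 1153–1169, Lemma 5.5 and its proof
  (pp. 15–16 of arXiv:math/9907186) [GeorgiiHiguchi2000].
-/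

noncomputable section

open MeasureTheory ProbabilityTheory Filter Topology SimpleGraph
open Literature.Probability.Percolation
open scoped ENNReal

namespace Literature.Probability.LatticeModels

/-! ### Positive correlations of the duplicated system -/

section ProdFKG

variable {d : ℕ} {β β' h h' : ℝ} {μ μ' : Measure (SpinConfig (Site d))}

/-- `|∫ f| ≤ 1` for `|f| ≤ 1` under a probability measure. [folklore] -/
theorem abs_integral_le_one_of_abs_le_one {Ω : Type*} [MeasurableSpace Ω] {κ : Measure Ω}
    [IsProbabilityMeasure κ] {f : Ω → ℝ} (hf : ∀ x, |f x| ≤ 1) : |∫ x, f x ∂κ| ≤ 1 := by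
  have h := norm_integral_le_of_norm_le_const (μ := κ) (f := f) (C := 1)
    (Eventually.of_forall fun x => by rw [Real.norm_eq_abs]; exact hf x)
  rwa [Real.norm_eq_abs, probReal_univ, one_mul] at h

/-- A bounded measurable real function is integrable under a probability measure. [folklore] -/
theorem integrable_of_abs_le_one {Ω : Type*} [MeasurableSpace Ω] {κ : Measure Ω}
    [IsProbabilityMeasure κ] {f : Ω → ℝ} (hfm : Measurable f) (hf : ∀ x, |f x| ≤ 1) : Integrable f κ :=
  Integrable.of_bound hfm.aestronglyMeasurable 1 (Eventually.of_forall fun x => by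
    rw [Real.norm_eq_abs]; exact hf x)

/-- **Positive correlations of the duplicated system** (Georgii–Higuchi 2000, proof of Lemma 5.5:
"`ν̂(fg) ≥ ∫μ(dω) μ̂(f(·-ω)) μ̂(g(·-ω)) ≥ ν̂(f) ν̂(g)` using the positive correlations of `μ̂` and
`μ`"): for tail-trivial Ising Gibbs measures `μ, μ'` on `ℤ^d` and bounded measurable `f, g` on pairs
which are decreasing in the first layer and increasing in the second,
`(∫ f dν̂)(∫ g dν̂) ≤ ∫ f g dν̂` with `ν̂ = μ ⊗ μ'`. [cite: GeorgiiHiguchi2000, Lemma 5.5 (proof, p. 16)] -/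
theorem prod_integral_mul_ge_of_antitone_monotone (hβ : 0 ≤ β) (hβ' : 0 ≤ β')
    (hμ : μ ∈ isingGibbsMeasures d β h) (hμt : IsTailTrivial μ)
    (hμ' : μ' ∈ isingGibbsMeasures d β' h') (hμ't : IsTailTrivial μ')
    {f g : SpinConfig (Site d) × SpinConfig (Site d) → ℝ}
    (hf₁ : ∀ η, Antitone fun ω => f (ω, η)) (hf₂ : ∀ ω, Monotone fun η => f (ω, η))
    (hg₁ : ∀ η, Antitone fun ω => g (ω, η)) (hg₂ : ∀ ω, Monotone fun η => g (ω, η))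
    (hfm : Measurable f) (hgm : Measurable g) (hfC : ∀ p, |f p| ≤ 1) (hgC : ∀ p, |g p| ≤ 1) :
    (∫ p, f p ∂(μ.prod μ')) * (∫ p, g p ∂(μ.prod μ')) ≤ ∫ p, f p * g p ∂(μ.prod μ') := by
  have hμG : IsGibbsMeasure (isingSpecification (zdGraph d) β h) μ := hμ
  have hμG' : IsGibbsMeasure (isingSpecification (zdGraph d) β' h') μ' := hμ'
  haveI := hμG.isProbabilityMeasure
  haveI := hμG'.isProbabilityMeasure
  -- the fibre integrals
  set F : SpinConfig (Site d) → ℝ := fun ω => ∫ η, f (ω, η) ∂μ' with hF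
  set Gf : SpinConfig (Site d) → ℝ := fun ω => ∫ η, g (ω, η) ∂μ' with hG
  set FG : SpinConfig (Site d) → ℝ := fun ω => ∫ η, f (ω, η) * g (ω, η) ∂μ' with hFG
  have hfgm : Measurable fun p => f p * g p := hfm.mul hgm
  have hfgC : ∀ p, |f p * g p| ≤ 1 := fun p => by
    rw [abs_mul]; exact mul_le_one₀ (hfC p) (abs_nonneg _) (hgC p)
  have hFm : Measurable F := (hfm.stronglyMeasurable.integral_prod_right' (ν := μ')).measurable
  have hGm : Measurable Gf := (hgm.stronglyMeasurable.integral_prod_right' (ν := μ')).measurable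
  have hFGm : Measurable FG := (hfgm.stronglyMeasurable.integral_prod_right' (ν := μ')).measurable
  have hFC : ∀ ω, |F ω| ≤ 1 := fun ω => abs_integral_le_one_of_abs_le_one fun η => hfC (ω, η)
  have hGC : ∀ ω, |Gf ω| ≤ 1 := fun ω => abs_integral_le_one_of_abs_le_one fun η => hgC (ω, η)
  have hFGC : ∀ ω, |FG ω| ≤ 1 := fun ω => abs_integral_le_one_of_abs_le_one fun η => hfgC (ω, η)
  -- Fubini
  have e1 : ∫ p, f p ∂(μ.prod μ') = ∫ ω, F ω ∂μ := integral_prod f (integrable_of_abs_le_one hfm hfC)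
  have e2 : ∫ p, g p ∂(μ.prod μ') = ∫ ω, Gf ω ∂μ := integral_prod g (integrable_of_abs_le_one hgm hgC)
  have e3 : ∫ p, f p * g p ∂(μ.prod μ') = ∫ ω, FG ω ∂μ :=
    integral_prod (fun p => f p * g p) (integrable_of_abs_le_one hfgm hfgC)
  rw [e1, e2, e3]
  -- FKG in the second layer, fibrewise
  have step1 : ∀ ω, F ω * Gf ω ≤ FG ω := fun ω =>
    isingGibbs_integral_mul_ge_of_isTailTrivial hβ' hμ' hμ't (hf₂ ω) (hg₂ ω)
      (hfm.comp measurable_prodMk_left) (hgm.comp measurable_prodMk_left)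
      (fun η => hfC (ω, η)) (fun η => hgC (ω, η))
  -- FKG in the first layer for the decreasing functions `F`, `Gf`
  have hFanti : Antitone F := fun ω₁ ω₂ hω =>
    integral_mono (integrable_of_abs_le_one (hfm.comp measurable_prodMk_left) fun η => hfC (ω₂, η))
      (integrable_of_abs_le_one (hfm.comp measurable_prodMk_left) fun η => hfC (ω₁, η))
      fun η => hf₁ η hω
  have hGanti : Antitone Gf := fun ω₁ ω₂ hω =>
    integral_mono (integrable_of_abs_le_one (hgm.comp measurable_prodMk_left) fun η => hgC (ω₂, η))
      (integrable_of_abs_le_one (hgm.comp measurable_prodMk_left) fun η => hgC (ω₁, η))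
      fun η => hg₁ η hω
  have step2 : (∫ ω, F ω ∂μ) * (∫ ω, Gf ω ∂μ) ≤ ∫ ω, F ω * Gf ω ∂μ := by
    have key := isingGibbs_integral_mul_ge_of_isTailTrivial hβ hμ hμt
      (f := fun ω => -F ω) (g := fun ω => -Gf ω)
      (fun ω₁ ω₂ hω => neg_le_neg (hFanti hω)) (fun ω₁ ω₂ hω => neg_le_neg (hGanti hω))
      hFm.neg hGm.neg (fun ω => by rw [abs_neg]; exact hFC ω) (fun ω => by rw [abs_neg]; exact hGC ω)
    simp only [integral_neg, neg_mul_neg] at key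
    exact key
  have step3 : ∫ ω, F ω * Gf ω ∂μ ≤ ∫ ω, FG ω ∂μ :=
    integral_mono (integrable_of_abs_le_one (hFm.mul hGm) fun ω => by
        rw [abs_mul]; exact mul_le_one₀ (hFC ω) (abs_nonneg _) (hGC ω))
      (integrable_of_abs_le_one hFGm hFGC) step1
  exact step2.trans step3

/-- An event of pairs is **increasing in the difference** `ω̂ - ω`: it is stable under decreasing the
first layer and increasing the second (Georgii–Higuchi 2000, proof of Lemma 5.5: "increasing
functions of the difference configuration `ω̂ - ω`"). We spell this out as a hypothesis rather than a
definition. The event form of `prod_integral_mul_ge_of_antitone_monotone`: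
`ν̂(A) ν̂(B) ≤ ν̂(A ∩ B)`. [cite: GeorgiiHiguchi2000, Lemma 5.5 (proof, p. 16)] -/
theorem prod_measureReal_inter_ge_of_antitone_monotone (hβ : 0 ≤ β) (hβ' : 0 ≤ β')
    (hμ : μ ∈ isingGibbsMeasures d β h) (hμt : IsTailTrivial μ)
    (hμ' : μ' ∈ isingGibbsMeasures d β' h') (hμ't : IsTailTrivial μ')
    {A B : Set (SpinConfig (Site d) × SpinConfig (Site d))} (hAm : MeasurableSet A) (hBm : MeasurableSet B)
    (hA : ∀ p q : SpinConfig (Site d) × SpinConfig (Site d), q.1 ≤ p.1 → p.2 ≤ q.2 → p ∈ A → q ∈ A)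
    (hB : ∀ p q : SpinConfig (Site d) × SpinConfig (Site d), q.1 ≤ p.1 → p.2 ≤ q.2 → p ∈ B → q ∈ B) :
    (μ.prod μ').real A * (μ.prod μ').real B ≤ (μ.prod μ').real (A ∩ B) := by
  have hμG : IsGibbsMeasure (isingSpecification (zdGraph d) β h) μ := hμ
  have hμG' : IsGibbsMeasure (isingSpecification (zdGraph d) β' h') μ' := hμ'
  haveI := hμG.isProbabilityMeasure
  haveI := hμG'.isProbabilityMeasure
  have hind : ∀ {S : Set (SpinConfig (Site d) × SpinConfig (Site d))},
      (∀ p q : SpinConfig (Site d) × SpinConfig (Site d), q.1 ≤ p.1 → p.2 ≤ q.2 → p ∈ S → q ∈ S) →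
      (∀ η, Antitone fun ω => S.indicator (1 : SpinConfig (Site d) × SpinConfig (Site d) → ℝ) (ω, η)) ∧
        (∀ ω, Monotone fun η => S.indicator (1 : SpinConfig (Site d) × SpinConfig (Site d) → ℝ) (ω, η)) := by
    intro S hS
    refine ⟨fun η ω₁ ω₂ hω => ?_, fun ω η₁ η₂ hη => ?_⟩
    · show S.indicator 1 (ω₂, η) ≤ S.indicator 1 (ω₁, η)
      by_cases h2 : (ω₂, η) ∈ S
      · rw [Set.indicator_of_mem h2, Set.indicator_of_mem (hS (ω₂, η) (ω₁, η) hω le_rfl h2)]; exact le_rfl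
      · rw [Set.indicator_of_notMem h2]; exact Set.indicator_nonneg (fun _ _ => zero_le_one) _
    · show S.indicator 1 (ω, η₁) ≤ S.indicator 1 (ω, η₂)
      by_cases h1 : (ω, η₁) ∈ S
      · rw [Set.indicator_of_mem h1, Set.indicator_of_mem (hS (ω, η₁) (ω, η₂) le_rfl hη h1)]; exact le_rfl
      · rw [Set.indicator_of_notMem h1]; exact Set.indicator_nonneg (fun _ _ => zero_le_one) _
  have hbd : ∀ {S : Set (SpinConfig (Site d) × SpinConfig (Site d))} (p : SpinConfig (Site d) × SpinConfig (Site d)),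
      |S.indicator (1 : SpinConfig (Site d) × SpinConfig (Site d) → ℝ) p| ≤ 1 := by
    intro S p
    by_cases hp : p ∈ S
    · rw [Set.indicator_of_mem hp]; simp
    · rw [Set.indicator_of_notMem hp]; simp
  have key := prod_integral_mul_ge_of_antitone_monotone hβ hβ' hμ hμt hμ' hμ't
    (hind hA).1 (hind hA).2 (hind hB).1 (hind hB).2
    (measurable_const.indicator hAm) (measurable_const.indicator hBm) hbd hbd
  rw [integral_indicator_one hAm, integral_indicator_one hBm] at key
  have h3 : ∫ p, A.indicator (1 : SpinConfig (Site d) × SpinConfig (Site d) → ℝ) p * B.indicator 1 p ∂(μ.prod μ') = (μ.prod μ').real (A ∩ B) := by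
    rw [← integral_indicator_one (hAm.inter hBm)]
    refine integral_congr_ae (Eventually.of_forall fun p => ?_)
    rw [Set.inter_indicator_one]
    rfl
  rwa [h3] at key

end ProdFKG

/-! ### Good sites and good crossings -/

section Good

/-- A good site (`ω z ≤ ω̂ z`) is not a bad site. [cite: GeorgiiHiguchi2000, Lemma 5.5 (proof, p. 16)] -/
theorem not_mem_spinSites_badConfig_of_le {p : SpinConfig (Site 2) × SpinConfig (Site 2)} {z : Site 2}
    (h : p.1 z ≤ p.2 z) : z ∉ spinSites 1 (badConfig p) := by
  rw [mem_spinSites_badConfig]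
  rintro ⟨h1, h2⟩
  rw [h1, h2] at h
  exact absurd h (by decide)

/-- Goodness of all sites of a walk is increasing in the difference configuration. [cite: GeorgiiHiguchi2000, Lemma 5.5 (proof, p. 16)] -/
theorem goodWalk_mono {p q : SpinConfig (Site 2) × SpinConfig (Site 2)} (h1 : q.1 ≤ p.1) (h2 : p.2 ≤ q.2)
    {u v : Site 2} {α : zdStarGraph.Walk u v} {P : Site 2 → Prop}
    (hα : ∀ z ∈ α.support, p.1 z ≤ p.2 z ∧ P z) : ∀ z ∈ α.support, q.1 z ≤ q.2 z ∧ P z :=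
  fun z hz => ⟨((h1 z).trans (hα z hz).1).trans (h2 z), (hα z hz).2⟩

/-- **An event of pairs decided by the two layers on a finite set is measurable.** [folklore] -/
theorem measurableSet_of_forall_eq_pair {K : Finset (Site 2)}
    {A : Set (SpinConfig (Site 2) × SpinConfig (Site 2))}
    (h : ∀ p q : SpinConfig (Site 2) × SpinConfig (Site 2),
      (∀ x ∈ K, p.1 x = q.1 x ∧ p.2 x = q.2 x) → (p ∈ A ↔ q ∈ A)) : MeasurableSet A := by
  set R : SpinConfig (Site 2) × SpinConfig (Site 2) → (K → ℤˣ × ℤˣ) := fun p x => (p.1 x, p.2 x) with hR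
  have hRm : Measurable R :=
    measurable_pi_lambda _ fun x =>
      ((measurable_pi_apply (x : Site 2)).comp measurable_fst).prodMk
        ((measurable_pi_apply (x : Site 2)).comp measurable_snd)
  have hA : A = R ⁻¹' (R '' A) := by
    refine Set.Subset.antisymm (Set.subset_preimage_image R A) ?_
    rintro q ⟨p, hp, hpq⟩
    refine (h p q fun x hx => ?_).1 hp
    have := congrFun hpq ⟨x, hx⟩
    simp only [hR, Prod.mk.injEq] at this
    exact this
  rw [hA]
  exact hRm (Set.to_countable _).measurableSet

/-- The good-crossing events are measurable (a countable union over the boxes containing the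
walk of events decided inside a box). [folklore] -/
theorem measurableSet_goodCrossing (u v : Site 2) (P : Site 2 → Prop) :
    MeasurableSet {p : SpinConfig (Site 2) × SpinConfig (Site 2) |
      ∃ α : zdStarGraph.Walk u v, ∀ z ∈ α.support, p.1 z ≤ p.2 z ∧ P z} := by
  have hE : {p : SpinConfig (Site 2) × SpinConfig (Site 2) |
      ∃ α : zdStarGraph.Walk u v, ∀ z ∈ α.support, p.1 z ≤ p.2 z ∧ P z} =
      ⋃ N : ℕ, {p | ∃ α : zdStarGraph.Walk u v, (∀ z ∈ α.support, z ∈ box 2 N) ∧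
        ∀ z ∈ α.support, p.1 z ≤ p.2 z ∧ P z} := by
    ext p
    simp only [Set.mem_setOf_eq, Set.mem_iUnion]
    constructor
    · rintro ⟨α, hα⟩
      obtain ⟨N, hN⟩ := (eventually_subset_box_holds (d := 2) α.support.toFinset).exists
      exact ⟨N, α, fun z hz => hN (List.mem_toFinset.2 hz), hα⟩
    · rintro ⟨N, α, -, hα⟩
      exact ⟨α, hα⟩
  rw [hE]
  refine MeasurableSet.iUnion fun N => measurableSet_of_forall_eq_pair (K := box 2 N) fun p q hpq => ?_
  constructor
  · rintro ⟨α, hαN, hα⟩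
    exact ⟨α, hαN, fun z hz => by
      obtain ⟨e1, e2⟩ := hpq z (hαN z hz)
      rw [← e1, ← e2]; exact hα z hz⟩
  · rintro ⟨α, hαN, hα⟩
    exact ⟨α, hαN, fun z hz => by
      obtain ⟨e1, e2⟩ := hpq z (hαN z hz)
      rw [e1, e2]; exact hα z hz⟩

end Good

/-! ### Enclosure by good crossings -/

section Enclosure

/-- The site `(k, 0)` of the horizontal axis. [folklore] -/
theorem axisSite_apply (k : ℤ) : (![k, 0] : Site 2) 0 = k ∧ (![k, 0] : Site 2) 1 = 0 := by simp

/-- **Enclosure by good crossings** (Georgii–Higuchi 2000, end of the proof of Lemma 5.5: "if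
`A_{x,y} ∩ B_{x,y}` occurs then `Δ` is surrounded by a `≤∗`circuit for the duplicated system"): if
`x = (-a, 0)` and `y = (b, 0)`, `a, b > n`, are joined by a `∗`-walk of good sites avoiding the lower
band `{|z₁| ≤ n, z₂ ≤ n}` and by one avoiding the upper band `{|z₁| ≤ n, z₂ ≥ -n}`, then every lattice
cluster of bad sites meeting `Λ_n` is finite (the eye lemma
`exists_mem_support_of_bandSemicircuits`). [cite: GeorgiiHiguchi2000, Lemma 5.5 (proof, p. 16)] -/
theorem badCluster_finite_of_goodCrossings {n a b : ℕ} (hna : n < a) (hnb : n < b)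
    {p : SpinConfig (Site 2) × SpinConfig (Site 2)}
    (hA : ∃ α : zdStarGraph.Walk (![-(a : ℤ), 0]) (![(b : ℤ), 0]),
      ∀ z ∈ α.support, p.1 z ≤ p.2 z ∧ ¬ (-(n : ℤ) ≤ z 0 ∧ z 0 ≤ n ∧ z 1 ≤ n))
    (hB : ∃ α : zdStarGraph.Walk (![-(a : ℤ), 0]) (![(b : ℤ), 0]),
      ∀ z ∈ α.support, p.1 z ≤ p.2 z ∧ ¬ (-(n : ℤ) ≤ z 0 ∧ z 0 ≤ n ∧ -(n : ℤ) ≤ z 1)) :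
    ∀ t ∈ box 2 n, (siteCluster (zdGraph 2) (spinSites 1 (badConfig p)) t).Finite := by
  classical
  obtain ⟨α, hα⟩ := hA
  obtain ⟨α', hα'⟩ := hB
  obtain ⟨H, hH⟩ := (eventually_subset_box_holds (d := 2) (α.support.toFinset ∪ α'.support.toFinset)).exists
  have hHα : ∀ z ∈ α.support, z ∈ box 2 H := fun z hz =>
    hH (Finset.mem_union_left _ (List.mem_toFinset.2 hz))
  have hHα' : ∀ z ∈ α'.support, z ∈ box 2 H := fun z hz =>
    hH (Finset.mem_union_right _ (List.mem_toFinset.2 hz))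
  intro t ht
  by_contra hinf
  rw [Set.not_finite] at hinf
  set O := spinSites 1 (badConfig p) with hO
  obtain ⟨w, hwC, hwH⟩ := hinf.exists_notMem_finset (box 2 H)
  obtain ⟨htO, -, hreach⟩ := hwC
  obtain ⟨q⟩ := hreach
  have hqO : ∀ z ∈ q.support, z ∈ O := support_subset_of_walk_siteOpenGraph q htO
  have hle : siteOpenGraph (zdGraph 2) O ≤ zdGraph 2 := fun u v huv => ((siteOpenGraph_adj _ _ _ _).1 huv).1
  set γ : (zdGraph 2).Walk t w := q.mapLe hle with hγ
  have hγO : ∀ z ∈ γ.support, z ∈ O := fun z hz => by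
    rw [hγ, Walk.support_mapLe_eq_support] at hz; exact hqO z hz
  have hu : -(n : ℤ) ≤ t 0 ∧ t 0 ≤ n ∧ -(n : ℤ) ≤ t 1 ∧ t 1 ≤ n := by
    rw [mem_box] at ht; exact ⟨(ht 0).1, (ht 0).2, (ht 1).1, (ht 1).2⟩
  obtain ⟨z, hzγ, hz⟩ := exists_mem_support_of_bandSemicircuits (aL := -(a : ℤ)) (bR := (b : ℤ))
    (c₁ := -(n : ℤ)) (c₂ := (n : ℤ)) (m := n) (by omega) (by omega)
    (axisSite_apply _).1 (axisSite_apply _).2 (axisSite_apply _).1 (axisSite_apply _).2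
    α (fun z hz => (hα z hz).2) α' (fun z hz => (hα' z hz).2) hHα hHα' hu hwH γ
  have hbad : z ∈ O := hγO z hzγ
  rcases hz with hz | hz
  · exact not_mem_spinSites_badConfig_of_le (hα z hz).1 hbad
  · exact not_mem_spinSites_badConfig_of_le (hα' z hz).1 hbad

variable {β β' : ℝ} {μ μ' : Measure (SpinConfig (Site 2))}

/-- **`ν̂(A_{x,y}) ν̂(B_{x,y}) ≤ ν̂(no infinite bad cluster meets Λ_n)`** (Georgii–Higuchi 2000, end
of the proof of Lemma 5.5: positive correlations of the duplicated system and enclosure), for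
tail-trivial `μ, μ'` in `𝒢(β, 0)`, `𝒢(β', 0)` on `ℤ²`, `x = (-a, 0)`, `y = (b, 0)`, `a, b > n`. [cite: GeorgiiHiguchi2000, Lemma 5.5 (proof, p. 16)] -/
theorem measure_goodCrossings_mul_le (hβ : 0 ≤ β) (hβ' : 0 ≤ β')
    (hμ : μ ∈ isingGibbsMeasures 2 β 0) (hμt : IsTailTrivial μ)
    (hμ' : μ' ∈ isingGibbsMeasures 2 β' 0) (hμ't : IsTailTrivial μ') {n a b : ℕ} (hna : n < a) (hnb : n < b) :
    (μ.prod μ') {p | ∃ α : zdStarGraph.Walk (![-(a : ℤ), 0]) (![(b : ℤ), 0]),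
        ∀ z ∈ α.support, p.1 z ≤ p.2 z ∧ ¬ (-(n : ℤ) ≤ z 0 ∧ z 0 ≤ n ∧ z 1 ≤ n)} *
      (μ.prod μ') {p | ∃ α : zdStarGraph.Walk (![-(a : ℤ), 0]) (![(b : ℤ), 0]),
        ∀ z ∈ α.support, p.1 z ≤ p.2 z ∧ ¬ (-(n : ℤ) ≤ z 0 ∧ z 0 ≤ n ∧ -(n : ℤ) ≤ z 1)} ≤
      (μ.prod μ') {p | ∀ t ∈ box 2 n, (siteCluster (zdGraph 2) (spinSites 1 (badConfig p)) t).Finite} := by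
  have hμG : IsGibbsMeasure (isingSpecification (zdGraph 2) β 0) μ := hμ
  have hμG' : IsGibbsMeasure (isingSpecification (zdGraph 2) β' 0) μ' := hμ'
  haveI := hμG.isProbabilityMeasure
  haveI := hμG'.isProbabilityMeasure
  set A := {p : SpinConfig (Site 2) × SpinConfig (Site 2) |
    ∃ α : zdStarGraph.Walk (![-(a : ℤ), 0]) (![(b : ℤ), 0]),
      ∀ z ∈ α.support, p.1 z ≤ p.2 z ∧ ¬ (-(n : ℤ) ≤ z 0 ∧ z 0 ≤ n ∧ z 1 ≤ n)} with hAdef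
  set B := {p : SpinConfig (Site 2) × SpinConfig (Site 2) |
    ∃ α : zdStarGraph.Walk (![-(a : ℤ), 0]) (![(b : ℤ), 0]),
      ∀ z ∈ α.support, p.1 z ≤ p.2 z ∧ ¬ (-(n : ℤ) ≤ z 0 ∧ z 0 ≤ n ∧ -(n : ℤ) ≤ z 1)} with hBdef
  set T := {p : SpinConfig (Site 2) × SpinConfig (Site 2) |
    ∀ t ∈ box 2 n, (siteCluster (zdGraph 2) (spinSites 1 (badConfig p)) t).Finite} with hTdef
  have hAm : MeasurableSet A := measurableSet_goodCrossing _ _ _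
  have hBm : MeasurableSet B := measurableSet_goodCrossing _ _ _
  have hsub : A ∩ B ⊆ T := fun p hp => badCluster_finite_of_goodCrossings hna hnb hp.1 hp.2
  have hreal : (μ.prod μ').real A * (μ.prod μ').real B ≤ (μ.prod μ').real T :=
    (prod_measureReal_inter_ge_of_antitone_monotone hβ hβ' hμ hμt hμ' hμ't hAm hBm
      (fun p q h1 h2 ⟨α, hα⟩ => ⟨α, goodWalk_mono h1 h2 hα⟩)
      (fun p q h1 h2 ⟨α, hα⟩ => ⟨α, goodWalk_mono h1 h2 hα⟩)).trans
      (measureReal_mono hsub)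
  have hfin : ∀ S : Set (SpinConfig (Site 2) × SpinConfig (Site 2)), (μ.prod μ') S ≠ ∞ := fun S =>
    measure_ne_top _ _
  rw [measureReal_def, measureReal_def, measureReal_def, ← ENNReal.toReal_mul] at hreal
  exact (ENNReal.toReal_le_toReal (ENNReal.mul_ne_top (hfin A) (hfin B)) (hfin T)).1 hreal

end Enclosure

/-! ### The lower crossing is the upper crossing of the reflected pair -/

section Reflect

/-- Coordinates of the reflection `R : (z₁, z₂) ↦ (z₁, -z₂)` in the horizontal axis. [cite: GeorgiiHiguchi2000, §2 p. 3] -/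
theorem reflectCoord_one_apply (z : Site 2) : reflectCoord 1 z 0 = z 0 ∧ reflectCoord 1 z 1 = -z 1 := by
  simp [reflectCoord_apply]

/-- The reflection in the horizontal axis fixes the axis. [cite: GeorgiiHiguchi2000, §2 p. 3] -/
theorem reflectCoord_one_axisSite (k : ℤ) : reflectCoord 1 (![k, 0] : Site 2) = ![k, 0] := by
  funext j
  rw [reflectCoord_apply]
  fin_cases j <;> simp

/-- The reflection in the horizontal axis is additive. [folklore] -/
theorem reflectCoord_one_sub (x y : Site 2) : reflectCoord 1 (x - y) = reflectCoord 1 x - reflectCoord 1 y := by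
  funext j
  simp only [reflectCoord_apply, Pi.sub_apply]
  split_ifs <;> ring

/-- Reflecting a `∗`-walk between two sites of the axis. [cite: GeorgiiHiguchi2000, §2 p. 3] -/
theorem exists_starWalk_reflect {a b : ℤ} (α : zdStarGraph.Walk (![a, 0] : Site 2) (![b, 0])) :
    ∃ α' : zdStarGraph.Walk (![a, 0] : Site 2) (![b, 0]), ∀ z, z ∈ α'.support ↔ reflectCoord 1 z ∈ α.support := by
  refine ⟨(α.map (starReflectHom 1)).copy (reflectCoord_one_axisSite a) (reflectCoord_one_axisSite b), fun z => ?_⟩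
  rw [Walk.support_copy, Walk.support_map, List.mem_map]
  constructor
  · rintro ⟨y, hy, rfl⟩
    rw [starReflectHom_apply, reflectCoord_reflectCoord]; exact hy
  · intro hz
    exact ⟨reflectCoord 1 z, hz, by rw [starReflectHom_apply, reflectCoord_reflectCoord]⟩

/-- **The lower good crossing is the upper good crossing of the reflected pair**: the preimage under
`R × R` (acting on both layers by `ω ↦ ω ∘ R`) of the event "a good `∗`-walk from `(a, 0)` to `(b, 0)`
avoiding the lower band" is the event "a good `∗`-walk from `(a, 0)` to `(b, 0)` avoiding the upper
band" (Georgii–Higuchi 2000, proof of Lemma 5.5: "the claim and its analogue for the lower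
half-plane"). [cite: GeorgiiHiguchi2000, Lemma 5.5 (proof, p. 16)] -/
theorem preimage_reflect_upperGoodCrossing (n : ℕ) (a b : ℤ) :
    (Prod.map (configRelabel (reflectCoord (d := 2) 1).toEquiv) (configRelabel (reflectCoord (d := 2) 1).toEquiv)) ⁻¹'
      {p : SpinConfig (Site 2) × SpinConfig (Site 2) | ∃ α : zdStarGraph.Walk (![a, 0] : Site 2) (![b, 0]),
        ∀ z ∈ α.support, p.1 z ≤ p.2 z ∧ ¬ (-(n : ℤ) ≤ z 0 ∧ z 0 ≤ n ∧ z 1 ≤ n)} =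
      {p : SpinConfig (Site 2) × SpinConfig (Site 2) | ∃ α : zdStarGraph.Walk (![a, 0] : Site 2) (![b, 0]),
        ∀ z ∈ α.support, p.1 z ≤ p.2 z ∧ ¬ (-(n : ℤ) ≤ z 0 ∧ z 0 ≤ n ∧ -(n : ℤ) ≤ z 1)} := by
  ext p
  simp only [Set.mem_preimage, Set.mem_setOf_eq, Prod.map_fst, Prod.map_snd, configRelabel_apply,
    reflectCoord_symm_apply]
  constructor
  · rintro ⟨α, hα⟩
    obtain ⟨α', hα'⟩ := exists_starWalk_reflect α
    refine ⟨α', fun z hz => ?_⟩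
    have h := hα (reflectCoord 1 z) ((hα' z).1 hz)
    rw [reflectCoord_reflectCoord, (reflectCoord_one_apply z).1, (reflectCoord_one_apply z).2] at h
    exact ⟨h.1, fun hb => h.2 (by omega)⟩
  · rintro ⟨α, hα⟩
    obtain ⟨α', hα'⟩ := exists_starWalk_reflect α
    refine ⟨α', fun z hz => ?_⟩
    have h := hα (reflectCoord 1 z) ((hα' z).1 hz)
    rw [(reflectCoord_one_apply z).1, (reflectCoord_one_apply z).2] at h
    exact ⟨h.1, fun hb => h.2 (by omega)⟩

/-- **The probability of a lower good crossing is the probability of an upper good crossing for the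
reflected pair** `(μ ∘ R⁻¹) ⊗ (μ' ∘ R⁻¹)`. [cite: GeorgiiHiguchi2000, Lemma 5.5 (proof, p. 16)] -/
theorem measure_lowerGoodCrossing_eq (μ μ' : Measure (SpinConfig (Site 2))) [SFinite μ] [SFinite μ']
    (n : ℕ) (a b : ℤ) :
    (μ.prod μ') {p : SpinConfig (Site 2) × SpinConfig (Site 2) | ∃ α : zdStarGraph.Walk (![a, 0] : Site 2) (![b, 0]),
        ∀ z ∈ α.support, p.1 z ≤ p.2 z ∧ ¬ (-(n : ℤ) ≤ z 0 ∧ z 0 ≤ n ∧ -(n : ℤ) ≤ z 1)} =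
      ((μ.map (configRelabel (reflectCoord (d := 2) 1).toEquiv)).prod
        (μ'.map (configRelabel (reflectCoord (d := 2) 1).toEquiv)))
        {p : SpinConfig (Site 2) × SpinConfig (Site 2) | ∃ α : zdStarGraph.Walk (![a, 0] : Site 2) (![b, 0]),
          ∀ z ∈ α.support, p.1 z ≤ p.2 z ∧ ¬ (-(n : ℤ) ≤ z 0 ∧ z 0 ≤ n ∧ z 1 ≤ n)} := by
  have hρ : Measurable (configRelabel (reflectCoord (d := 2) 1).toEquiv : SpinConfig (Site 2) → SpinConfig (Site 2)) :=
    (configRelabel _).measurable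
  rw [Measure.map_prod_map _ _ hρ hρ, Measure.map_apply (hρ.prodMap hρ) (measurableSet_goodCrossing _ _ _),
    preimage_reflect_upperGoodCrossing]

/-- **Translations conjugate under the reflection**: `R ∘ θ_v = θ_{Rv} ∘ R` on configurations. [folklore] -/
theorem configRelabel_reflectCoord_one_comp_configShift (v : Site 2) :
    (configRelabel (reflectCoord (d := 2) 1).toEquiv : SpinConfig (Site 2) → SpinConfig (Site 2)) ∘ configShift v =
      configShift (reflectCoord 1 v) ∘ configRelabel (reflectCoord (d := 2) 1).toEquiv := by
  funext σ; funext y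
  simp only [Function.comp_apply, configRelabel_apply, configShift_apply, reflectCoord_symm_apply,
    reflectCoord_one_sub, reflectCoord_reflectCoord]

/-- The reflection of a unit vector is a unit vector in the same coordinate direction. [folklore] -/
theorem reflectCoord_one_single (i : Fin 2) (s : ℤˣ) :
    ∃ t : ℤˣ, reflectCoord 1 (Pi.single i (s : ℤ) : Site 2) = Pi.single i (t : ℤ) := by
  fin_cases i
  · refine ⟨s, ?_⟩
    funext j
    rw [reflectCoord_apply]
    fin_cases j <;> simp
  · refine ⟨-s, ?_⟩
    funext j
    rw [reflectCoord_apply]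
    fin_cases j <;> simp

/-- **The lower claim from the upper claim for the reflected measure**: the `μ ⊗ (μ ∘ θ_v⁻¹)`-probability
of a lower good crossing equals the `μ_R ⊗ (μ_R ∘ θ_{Rv}⁻¹)`-probability of an upper good crossing,
`μ_R = μ ∘ R⁻¹`. [cite: GeorgiiHiguchi2000, Lemma 5.5 (proof, p. 16)] -/
theorem measure_lowerGoodCrossing_shift_eq (μ : Measure (SpinConfig (Site 2))) [SFinite μ] (v : Site 2)
    (n : ℕ) (a b : ℤ) :
    (μ.prod (μ.map (configShift v)))
        {p : SpinConfig (Site 2) × SpinConfig (Site 2) | ∃ α : zdStarGraph.Walk (![a, 0] : Site 2) (![b, 0]),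
          ∀ z ∈ α.support, p.1 z ≤ p.2 z ∧ ¬ (-(n : ℤ) ≤ z 0 ∧ z 0 ≤ n ∧ -(n : ℤ) ≤ z 1)} =
      ((μ.map (configRelabel (reflectCoord (d := 2) 1).toEquiv)).prod
        ((μ.map (configRelabel (reflectCoord (d := 2) 1).toEquiv)).map (configShift (reflectCoord 1 v))))
        {p : SpinConfig (Site 2) × SpinConfig (Site 2) | ∃ α : zdStarGraph.Walk (![a, 0] : Site 2) (![b, 0]),
          ∀ z ∈ α.support, p.1 z ≤ p.2 z ∧ ¬ (-(n : ℤ) ≤ z 0 ∧ z 0 ≤ n ∧ z 1 ≤ n)} := by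
  have hρ : Measurable (configRelabel (reflectCoord (d := 2) 1).toEquiv : SpinConfig (Site 2) → SpinConfig (Site 2)) :=
    (configRelabel _).measurable
  haveI : SFinite (μ.map (configShift (S := ℤˣ) v)) := inferInstance
  rw [measure_lowerGoodCrossing_eq, Measure.map_map hρ (configShift v).measurable,
    configRelabel_reflectCoord_one_comp_configShift,
    ← Measure.map_map (configShift (reflectCoord 1 v)).measurable hρ]

end Reflect

end Literature.Probability.LatticeModels
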